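import Literature.Analysis.Asymptotics.LaplaceMethodMorseBottFibred
import HarnessLib

/-!
# The Laplace method THROUGH A MEASURABLE CHART WITH DENSITY: integrals over an abstract measure space
# `(X, μ)` (a manifold, a compact group, a product of groups) whose phase has its minimum inside the image
# of a chart `Θ : ℝ^d ⊇ Ω → X` with `μ|_{Θ(Ω)} = Θ_*(J · dx|_Ω)`

Topic `Literature/Analysis/Asymptotics`; sequel of `LaplaceMethodMultivariate.lean` (`tendsto_laplaceMethod`:
one non-degenerate minimum in `ℝ^d`) and `LaplaceMethodMorseBottFibred.lean` (`tendsto_laplaceMethod_fibred`: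
Morse–Bott ∕ parametrised form in fibred coordinates `M × ℝ^m`).  Everything here is PROVED; no definitions, no
named facts.

WHAT THIS FILE ADDS.  The two Laplace theorems of the tree integrate against LEBESGUE measure on a Euclidean space.
A consumer whose integral runs over an abstract measure space `(X, μ)` — the Haar measure of a compact group `G` or
of `G^E` (lattice gauge fields), the volume of a submanifold — reaches them through a chart: a measurable map
`Θ : V → X` (`V ≅ ℝ^d`), injective on a measurable `Ω ⊆ V`, along which `μ` restricted to the coordinate patch
`Θ(Ω)` is the push-forward of Lebesgue measure with a density `J ≥ 0` («`dμ = J(x) dx` in local coordinates»;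
for Haar measure in exponential coordinates `J = σ₀·|det((1 − e^{−adX})∕adX)|`, Helgason Ch. I Thm 1.14 —
in the tree as `Balaban1983to89.HaarExponentialChart.IsChartRep.haar_restrict_image_eq_smul_chartMeasureOn`).  This
file performs, once and for all, the measure-theoretic half of that reduction:

* §1 `setIntegral_image_eq_of_chart`, `integrableOn_image_iff_of_chart` — the chart identity
  `μ|_{Θ(Ω)} = Θ_*((J·vol)|_Ω)` (hypothesis `hchart`, stated with `Measure.map` ∕ `withDensity`) turns
  `∫_{Θ(Ω)} F dμ` into `∫_Ω J · F∘Θ dx` and transfers integrability;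
* §2 ★ `tendsto_laplaceMethod_chart` — ONE NON-DEGENERATE MINIMUM INSIDE A CHART: if `f∘Θ` has the second-order
  Peano expansion `f(Θ v) = f(Θ x₀) + ½⟪A(v − x₀), v − x₀⟫ + o(‖v − x₀‖²)` at an interior point `x₀ ∈ Ω`
  (`A` symmetric positive definite), `f∘Θ ≥ f(Θ x₀) + η(δ)` on `Ω` off the ball `‖v − x₀‖ < δ`, `f ≥ f(Θ x₀) + η₀`
  OFF the patch `Θ(Ω)` (`η₀ > 0`: the minimum is not approached elsewhere on `X`), `J` and `φ∘Θ` continuous at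
  `x₀`, and `e^{−β₀ f} φ ∈ L¹(μ)` for one `β₀`, then
  `β^{d/2} ∫_X e^{−β(f − f(Θ x₀))} φ dμ ⟶ (2π)^{d/2} (det A)^{−1/2} · J(x₀) φ(Θ x₀)`;
  `tendsto_gibbs_expectation_laplace_chart`: the Gibbs mean `∫ e^{−βf} φ dμ ∕ ∫ e^{−βf} dμ → φ(Θ x₀)` (all
  constants cancel — no knowledge of `J(x₀)` or `det A` needed);
* §3 ★ `tendsto_laplaceMethod_fibred_chart` — MORSE–BOTT THROUGH A FIBRED CHART: `Ψ : M × V → X` with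
  `μ|_{Ψ(W)} = Ψ_*((J · ν ⊗ dy)|_W)` on a measurable `W ⊇ M × {‖y‖ < r}` (tubular coordinates around the critical
  manifold `Ψ(M × {0})`, `ν` the measure carried by the manifold, `J` the Jacobian), the hypotheses of
  `tendsto_laplaceMethod_fibred` for `f∘Ψ` and `J·φ∘Ψ` near `M × {0}`, separation on `W` off the zero section and
  OFF `Ψ(W)`; then `β^{m/2} ∫_X e^{−β(f − f₀)} φ dμ ⟶ (2π)^{m/2} ∫_M J(p,0) φ(Ψ(p,0)) (det A p)^{−1/2} dν(p)`.

This is exactly the «(T) tubular neighbourhoods `N_i(ε)` with diffeomorphisms `S_i` … Jacobian» step of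
Hasenpflug–Rudolf–Sprungk's Assumption 3 ∕ Hwang's theorem, SPLIT into its two halves: the differential topology
(producing `Ψ`, `W`, `J` and the identity `hchart`) stays with the consumer; the passage from `hchart` to the
asymptotics is done here (split `X = Ψ(W) ⊔ Ψ(W)ᶜ`; inside, pull back and apply the Euclidean theorem to the phase
extended by `f₀ + 1` off `W` and the amplitude `1_W · J · φ∘Ψ`; outside, `≤ e^{−(β−β₀)η₀}·‖e^{−β₀(f−f₀)}φ‖₁ =
o(β^{−m/2})`).

HONEST FRAMING: measure-theoretic glue (change of variables + an exponentially small tail); an input for «`β → ∞`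
at fixed box» ∕ semiclassical arguments on compact groups (cell `ym-ir`, row 43, brick M1 of the LEAD's
T1-tree-exact roadmap), width 0 by itself toward any lattice statement; the Yang–Mills mass gap (Clay) is NOT
touched; `R4` closes only `BalabanLadder.UV`.

## References
* K. W. Breitung, *Asymptotic Approximations for Probability Integrals*, LNM 1592 (1994): Thm 41 p. 56 (interior
  non-degenerate maximum, leading order with the constant), §2.3 Definitions 4–5 pp. 14–15 (regular transformations
  ∕ local coordinate systems of a manifold, through which the Euclidean theorems are applied). [Breitung1994]
* M. Hasenpflug, D. Rudolf, B. Sprungk, *Wasserstein convergence rates of increasingly concentrating probability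
  measures*, Ann. Appl. Probab. 34 (2024) = arXiv:2207.08551, §3.1 Assumption 3 (M)(T)(P) (tubular coordinates
  `S_i`, the reference measure in those coordinates) and App. 4.1 Thm 16 ∕ Remark 17. [HasenpflugRudolfSprungk2024]
* C.-R. Hwang, *Laplace's method revisited: weak convergence of probability measures*, Ann. Probab. 8 (1980)
  1177–1182 (minimum set a manifold; an arbitrary reference measure with a density). [Hwang1980]
* S. Helgason, *Groups and Geometric Analysis*, AMS (2000), Ch. I §1 Thm 1.14 (13) p. 96 (Haar measure in
  exponential coordinates — the model instance of `hchart`). [Helgason2000]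
-/

noncomputable section

open _root_.MeasureTheory _root_.Filter _root_.Set _root_.Module
open scoped _root_.Topology _root_.Real _root_.InnerProductSpace _root_.ENNReal _root_.NNReal

namespace Literature.Analysis.Asymptotics

variable {V : Type*} [NormedAddCommGroup V] [InnerProductSpace ℝ V] [FiniteDimensional ℝ V]
  [MeasurableSpace V] [BorelSpace V]
variable {X : Type*} [MeasurableSpace X] {μ : Measure X}

/-! ## §1 The chart identity: pull-back of integrals and of integrability -/

section Chart

variable {Y : Type*} [MeasurableSpace Y] {κ : Measure Y}

/-- **Pull-back of an integral along a measurable chart with density.**  If `Θ : Y → X` is measurable and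
`μ|_{Θ(Ω)} = Θ_*((J · κ)|_Ω)` for a measurable `Ω ⊆ Y` and a measurable density `J ≥ 0` on `Ω` (densities enter
`withDensity` through `ENNReal.ofReal`), then for every measurable `F : X → ℝ`,
`∫_{Θ(Ω)} F dμ = ∫_Ω J(v) · F(Θ v) dκ(v)` — «`dμ = J dx` in the local coordinates `Θ`».
[cite: Breitung1994, §2.3 Definitions 4–5 pp. 14–15 (regular transformations, local coordinates); Thm 41 p. 56]
[cite: Helgason2000, Ch. I §1 Thm 1.14 (13) p. 96 (the model case: Haar measure in exponential coordinates)] -/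
theorem setIntegral_image_eq_of_chart {Θ : Y → X} {Ω : Set Y} {J : Y → ℝ}
    (hΘ : Measurable Θ) (hΩ : MeasurableSet Ω) (hJm : Measurable J) (hJ0 : ∀ v ∈ Ω, 0 ≤ J v)
    (hchart : μ.restrict (Θ '' Ω) = ((κ.restrict Ω).withDensity fun v => ENNReal.ofReal (J v)).map Θ)
    {F : X → ℝ} (hF : Measurable F) :
    ∫ x in Θ '' Ω, F x ∂μ = ∫ v in Ω, J v * F (Θ v) ∂κ := by
  rw [hchart, integral_map hΘ.aemeasurable hF.aestronglyMeasurable,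
    integral_withDensity_eq_integral_toReal_smul hJm.ennreal_ofReal
      (Eventually.of_forall fun v => ENNReal.ofReal_lt_top)]
  refine setIntegral_congr_fun hΩ fun v hv => ?_
  simp only [ENNReal.toReal_ofReal (hJ0 v hv), smul_eq_mul]

/-- **Transfer of integrability along the chart**: under the same chart identity, a measurable `F : X → ℝ` is
integrable on the patch `Θ(Ω)` iff `J · F∘Θ` is integrable on `Ω`.
[cite: Breitung1994, §2.3 Definitions 4–5 pp. 14–15; Thm 41 p. 56] -/
theorem integrableOn_image_iff_of_chart {Θ : Y → X} {Ω : Set Y} {J : Y → ℝ}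
    (hΘ : Measurable Θ) (hΩ : MeasurableSet Ω) (hJm : Measurable J) (hJ0 : ∀ v ∈ Ω, 0 ≤ J v)
    (hchart : μ.restrict (Θ '' Ω) = ((κ.restrict Ω).withDensity fun v => ENNReal.ofReal (J v)).map Θ)
    {F : X → ℝ} (hF : Measurable F) :
    IntegrableOn F (Θ '' Ω) μ ↔ IntegrableOn (fun v => J v * F (Θ v)) Ω κ := by
  rw [IntegrableOn, hchart, integrable_map_measure hF.aestronglyMeasurable hΘ.aemeasurable]
  have key : Integrable (F ∘ Θ) ((κ.restrict Ω).withDensity fun v => ENNReal.ofReal (J v)) ↔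
      Integrable (fun v => (J v).toNNReal • (F ∘ Θ) v) (κ.restrict Ω) :=
    integrable_withDensity_iff_integrable_smul hJm.real_toNNReal
  rw [key, IntegrableOn]
  refine integrable_congr ((ae_restrict_mem hΩ).mono fun v hv => ?_)
  simp only [Function.comp_apply, NNReal.smul_def, Real.coe_toNNReal _ (hJ0 v hv), smul_eq_mul]

end Chart

/-! ## §2 One non-degenerate minimum inside a chart -/

section Point

/-- **Laplace's method through a chart: one non-degenerate interior minimum.**  Let `(X, μ)` be a measure space,
`V` a finite-dimensional real inner product space of dimension `d` (Lebesgue measure), `Θ : V → X` measurable,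
`Ω ⊆ V` measurable with `Θ(Ω)` measurable and `Ω` a neighbourhood of `x₀`, `J : V → ℝ` measurable, `≥ 0` on `Ω`,
with the CHART IDENTITY `μ|_{Θ(Ω)} = Θ_*((J · dx)|_Ω)` («`dμ = J dx` in the coordinates `Θ`»).  Let
`f, φ : X → ℝ` be measurable with

* (Peano expansion of the phase in the chart) `f(Θ v) = f(Θ x₀) + ½⟪A(v − x₀), v − x₀⟫ + o(‖v − x₀‖²)` at `x₀`,
  `A` symmetric with `⟪Ay, y⟫ > 0` for `y ≠ 0`;
* (separation inside the patch) for every `δ > 0` some `η > 0` with `f(Θ v) ≥ f(Θ x₀) + η` for `v ∈ Ω`,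
  `‖v − x₀‖ ≥ δ`;
* (separation off the patch) some `η₀ > 0` with `f ≥ f(Θ x₀) + η₀` on `X ∖ Θ(Ω)`;
* `J` and `φ∘Θ` continuous at `x₀`; `e^{−β₀ f} φ ∈ L¹(μ)` for one `β₀`.

Then `β^{d/2} ∫_X e^{−β (f − f(Θ x₀))} φ dμ ⟶ (2π)^{d/2} (det A)^{−1/2} · J(x₀) · φ(Θ x₀)` as `β → ∞` —
Breitung's Theorem 41 read through a local coordinate system (his §2.3), the coordinate density `J(x₀)`
multiplying the leading term (for Haar measure in exponential coordinates at the identity `J(0) = σ₀`,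
Helgason Thm 1.14).  Proof: `X = Θ(Ω) ⊔ Θ(Ω)ᶜ`; the patch integral is pulled back
(`setIntegral_image_eq_of_chart`) and is the integral of `tendsto_laplaceMethod` for the phase `f∘Θ` extended
by `f(Θ x₀) + 1` off `Ω` and the amplitude `1_Ω · J · φ∘Θ`; the complement is `≤ e^{−(β−β₀)η₀} ‖e^{−β₀(f−f₀)}φ‖₁`.
[cite: Breitung1994, Thm 41 (5.24) p. 56 with §2.3 Definitions 4–5 pp. 14–15 (local coordinates)]
[cite: Hwang1980, main theorem (reference measure with a density; here the one-point case)] -/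
theorem tendsto_laplaceMethod_chart {Θ : V → X} {Ω : Set V} {J : V → ℝ} {x₀ : V}
    {f φ : X → ℝ} {A : V →ₗ[ℝ] V}
    (hA : A.IsSymmetric) (hpos : ∀ y, y ≠ 0 → 0 < ⟪A y, y⟫_ℝ)
    (hΘ : Measurable Θ) (hΩ : MeasurableSet Ω) (hΘΩ : MeasurableSet (Θ '' Ω)) (hx₀ : Ω ∈ 𝓝 x₀)
    (hJm : Measurable J) (hJ0 : ∀ v ∈ Ω, 0 ≤ J v)
    (hchart : μ.restrict (Θ '' Ω) = ((volume.restrict Ω).withDensity fun v => ENNReal.ofReal (J v)).map Θ)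
    (hfm : Measurable f) (hφm : Measurable φ)
    (hS2 : (fun v => f (Θ v) - f (Θ x₀) - (1 / 2) * ⟪A (v - x₀), v - x₀⟫_ℝ) =o[𝓝 x₀] fun v => ‖v - x₀‖ ^ 2)
    (hsep : ∀ δ : ℝ, 0 < δ → ∃ η : ℝ, 0 < η ∧ ∀ v ∈ Ω, δ ≤ ‖v - x₀‖ → f (Θ x₀) + η ≤ f (Θ v))
    (hout : ∃ η₀ : ℝ, 0 < η₀ ∧ ∀ x, x ∉ Θ '' Ω → f (Θ x₀) + η₀ ≤ f x)
    (hJ : ContinuousAt J x₀) (hφ : ContinuousAt (fun v => φ (Θ v)) x₀)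
    {β₀ : ℝ} (hint : Integrable (fun x => Real.exp (-β₀ * f x) * φ x) μ) :
    Tendsto (fun β : ℝ => β ^ ((finrank ℝ V : ℝ) / 2) *
        ∫ x, Real.exp (-β * (f x - f (Θ x₀))) * φ x ∂μ) atTop
      (𝓝 ((2 * π) ^ ((finrank ℝ V : ℝ) / 2) / Real.sqrt (LinearMap.det A) * (J x₀ * φ (Θ x₀)))) := by
  classical
  set d := finrank ℝ V with hd
  set f₀ := f (Θ x₀) with hf₀
  have hx₀Ω : x₀ ∈ Ω := mem_of_mem_nhds hx₀
  -- the pulled-back phase (extended by `f₀ + 1` off `Ω`) and amplitude (`1_Ω · J · φ∘Θ`) on `V`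
  set S : V → ℝ := Ω.piecewise (fun v => f (Θ v)) (fun _ => f₀ + 1) with hS
  set g : V → ℝ := Ω.indicator fun v => J v * φ (Θ v) with hg
  have hSΩ : ∀ v ∈ Ω, S v = f (Θ v) := fun v hv => Set.piecewise_eq_of_mem _ _ _ hv
  have hSΩc : ∀ v ∉ Ω, S v = f₀ + 1 := fun v hv => Set.piecewise_eq_of_notMem _ _ _ hv
  have hSx₀ : S x₀ = f₀ := by rw [hSΩ x₀ hx₀Ω]
  have hSm : Measurable S := Measurable.piecewise hΩ (hfm.comp hΘ) measurable_const
  have hgm : Measurable g := (hJm.mul (hφm.comp hΘ)).indicator hΩ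
  have hgx₀ : g x₀ = J x₀ * φ (Θ x₀) := by simp only [hg, Set.indicator_of_mem hx₀Ω]
  -- the hypotheses of the Euclidean theorem for `(S, g)`
  have hSev : S =ᶠ[𝓝 x₀] fun v => f (Θ v) := by
    filter_upwards [hx₀] with v hv using hSΩ v hv
  have hS2' : (fun v => S v - S x₀ - (1 / 2) * ⟪A (v - x₀), v - x₀⟫_ℝ) =o[𝓝 x₀] fun v => ‖v - x₀‖ ^ 2 := by
    refine hS2.congr' ?_ EventuallyEq.rfl
    filter_upwards [hSev] with v hv
    rw [hv, hSx₀]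
  have hsep' : ∀ δ : ℝ, 0 < δ → ∃ η : ℝ, 0 < η ∧ ∀ v, δ ≤ ‖v - x₀‖ → S x₀ + η ≤ S v := by
    intro δ hδ
    obtain ⟨η, hη, h⟩ := hsep δ hδ
    refine ⟨min η 1, lt_min hη one_pos, fun v hv => ?_⟩
    rw [hSx₀]
    by_cases hvΩ : v ∈ Ω
    · rw [hSΩ v hvΩ]
      linarith [h v hvΩ hv, min_le_left η 1]
    · rw [hSΩc v hvΩ]
      linarith [min_le_right η 1]
  have hg' : ContinuousAt g x₀ := by
    have hev : (fun v => J v * φ (Θ v)) =ᶠ[𝓝 x₀] g := by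
      filter_upwards [hx₀] with v hv
      simp only [hg, Set.indicator_of_mem hv]
    exact (hJ.mul hφ).congr hev
  -- integrability of the pulled-back weight, through the chart identity
  have hFm : ∀ β : ℝ, Measurable fun x => Real.exp (-β * f x) * φ x := fun β =>
    (Real.measurable_exp.comp (hfm.const_mul _)).mul hφm
  have hint' : Integrable (fun v => Real.exp (-β₀ * S v) * g v) := by
    have h2 := (integrableOn_image_iff_of_chart hΘ hΩ hJm hJ0 hchart (hFm β₀)).1 hint.integrableOn
    rw [← integrable_indicator_iff hΩ] at h2
    refine h2.congr (Eventually.of_forall fun v => ?_)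
    by_cases hv : v ∈ Ω
    · simp only [Set.indicator_of_mem hv, hg, hSΩ v hv]
      ring
    · simp only [Set.indicator_of_notMem hv, hg, mul_zero]
  -- ★ the Euclidean Laplace theorem on `V`
  have hmain := tendsto_laplaceMethod hA hpos hSm hgm hS2' hsep' hg' hint'
  simp only [hgx₀, hSx₀] at hmain
  -- the global lower bound `f ≥ f₀` (window coercivity + the two separations)
  obtain ⟨η₀, hη₀, hout⟩ := hout
  have hfge : ∀ x, f₀ ≤ f x := by
    obtain ⟨c, hc, hcoer⟩ := exists_pos_mul_norm_sq_le_inner hA hpos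
    have hc4 : 0 < c / 4 := by positivity
    obtain ⟨ρ, hρ, hT⟩ := Metric.eventually_nhds_iff.1 (hS2'.def hc4)
    obtain ⟨η, hη, hsepρ⟩ := hsep' ρ hρ
    have hSge : ∀ v, S x₀ ≤ S v := by
      intro v
      rcases lt_or_ge ‖v - x₀‖ ρ with h | h
      · have h1 := hT (show dist v x₀ < ρ by rwa [dist_eq_norm])
        rw [Real.norm_eq_abs, Real.norm_eq_abs, abs_of_nonneg (by positivity : (0 : ℝ) ≤ ‖v - x₀‖ ^ 2)] at h1
        have h2 := hcoer (v - x₀)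
        have h3 := neg_abs_le (S v - S x₀ - (1 / 2) * ⟪A (v - x₀), v - x₀⟫_ℝ)
        nlinarith
      · linarith [hsepρ v h]
    intro x
    by_cases hx : x ∈ Θ '' Ω
    · obtain ⟨v, hv, rfl⟩ := hx
      have := hSge v
      rwa [hSx₀, hSΩ v hv] at this
    · linarith [hout x hx]
  -- the integrands on `X`, their integrable envelope, the tail estimate off the patch
  set F : ℝ → X → ℝ := fun β x => Real.exp (-β * (f x - f₀)) * φ x with hF
  have hFm' : ∀ β, Measurable (F β) := fun β =>
    (Real.measurable_exp.comp ((hfm.sub measurable_const).const_mul _)).mul hφm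
  set K : X → ℝ := fun x => Real.exp (-β₀ * (f x - f₀)) * |φ x| with hK
  have hKint : Integrable K μ := by
    have hKeq : K = fun x => Real.exp (β₀ * f₀) * |Real.exp (-β₀ * f x) * φ x| := by
      funext x
      simp only [hK]
      rw [abs_mul, abs_of_pos (Real.exp_pos _), show -β₀ * (f x - f₀) = β₀ * f₀ + -β₀ * f x by ring,
        Real.exp_add]
      ring
    rw [hKeq]
    exact hint.abs.const_mul _
  have hKnn : ∀ x, 0 ≤ K x := fun x => by positivity
  have hFK : ∀ β, β₀ ≤ β → ∀ x, |F β x| ≤ K x := by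
    intro β hβ x
    simp only [hF, hK, abs_mul, abs_of_pos (Real.exp_pos _)]
    refine mul_le_mul_of_nonneg_right ?_ (abs_nonneg _)
    rw [Real.exp_le_exp]
    have := hfge x
    nlinarith
  have hFint : ∀ β, β₀ ≤ β → Integrable (F β) μ := fun β hβ =>
    Integrable.mono' hKint (hFm' β).aestronglyMeasurable
      (Eventually.of_forall fun x => by rw [Real.norm_eq_abs]; exact hFK β hβ x)
  have hFtail : ∀ β, β₀ ≤ β → ∀ x, x ∉ Θ '' Ω → |F β x| ≤ Real.exp (-(β - β₀) * η₀) * K x := by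
    intro β hβ x hx
    have hfx := hout x hx
    simp only [hF, hK, abs_mul, abs_of_pos (Real.exp_pos _)]
    rw [← mul_assoc, ← Real.exp_add]
    refine mul_le_mul_of_nonneg_right ?_ (abs_nonneg _)
    rw [Real.exp_le_exp]
    have h1 : 0 ≤ (β - β₀) * (f x - f₀ - η₀) := mul_nonneg (sub_nonneg.2 hβ) (by linarith)
    nlinarith
  -- (a) the patch integral IS the Euclidean Laplace integral of `(S, g)`
  have hin : ∀ β, ∫ x in Θ '' Ω, F β x ∂μ = ∫ v, Real.exp (-β * (S v - f₀)) * g v := by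
    intro β
    rw [setIntegral_image_eq_of_chart hΘ hΩ hJm hJ0 hchart (hFm' β), ← integral_indicator hΩ]
    refine integral_congr_ae (Eventually.of_forall fun v => ?_)
    by_cases hv : v ∈ Ω
    · simp only [Set.indicator_of_mem hv, hF, hg, hSΩ v hv]
      ring
    · simp only [Set.indicator_of_notMem hv, hg, mul_zero]
  -- (b) the complement of the patch is negligible
  have htail : Tendsto (fun β : ℝ => β ^ ((d : ℝ) / 2) * ∫ x in (Θ '' Ω)ᶜ, F β x ∂μ) atTop (𝓝 0) := by
    have hKI : 0 ≤ ∫ x, K x ∂μ := integral_nonneg hKnn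
    have hlim : Tendsto (fun β : ℝ => Real.exp (β₀ * η₀) * (∫ x, K x ∂μ) * (β ^ ((d : ℝ) / 2) * Real.exp (-η₀ * β)))
        atTop (𝓝 0) := by
      have := (tendsto_rpow_mul_exp_neg_mul_atTop_nhds_zero ((d : ℝ) / 2) η₀ hη₀).const_mul
        (Real.exp (β₀ * η₀) * ∫ x, K x ∂μ)
      simpa using this
    refine squeeze_zero_norm' ?_ hlim
    filter_upwards [eventually_ge_atTop β₀, eventually_gt_atTop 0] with β hβ hβpos
    rw [Real.norm_eq_abs, abs_mul, abs_of_nonneg (by positivity : 0 ≤ β ^ ((d : ℝ) / 2))]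
    have hI : |∫ x in (Θ '' Ω)ᶜ, F β x ∂μ| ≤ Real.exp (-(β - β₀) * η₀) * ∫ x, K x ∂μ := by
      calc |∫ x in (Θ '' Ω)ᶜ, F β x ∂μ| ≤ ∫ x in (Θ '' Ω)ᶜ, |F β x| ∂μ := abs_integral_le_integral_abs
        _ ≤ ∫ x in (Θ '' Ω)ᶜ, Real.exp (-(β - β₀) * η₀) * K x ∂μ := by
            refine setIntegral_mono_on (hFint β hβ).abs.integrableOn (hKint.const_mul _).integrableOn
              hΘΩ.compl fun x hx => hFtail β hβ x hx
        _ = Real.exp (-(β - β₀) * η₀) * ∫ x in (Θ '' Ω)ᶜ, K x ∂μ := integral_const_mul _ _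
        _ ≤ Real.exp (-(β - β₀) * η₀) * ∫ x, K x ∂μ :=
            mul_le_mul_of_nonneg_left (setIntegral_le_integral hKint (Eventually.of_forall hKnn))
              (Real.exp_pos _).le
    calc β ^ ((d : ℝ) / 2) * |∫ x in (Θ '' Ω)ᶜ, F β x ∂μ|
        ≤ β ^ ((d : ℝ) / 2) * (Real.exp (-(β - β₀) * η₀) * ∫ x, K x ∂μ) := by gcongr
      _ = Real.exp (β₀ * η₀) * (∫ x, K x ∂μ) * (β ^ ((d : ℝ) / 2) * Real.exp (-η₀ * β)) := by
          rw [show -(β - β₀) * η₀ = β₀ * η₀ + -η₀ * β by ring, Real.exp_add]; ring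
  -- (c) assemble
  have hsum := hmain.add htail
  rw [add_zero] at hsum
  refine hsum.congr' ?_
  filter_upwards [eventually_ge_atTop β₀] with β hβ
  rw [← hin β, ← mul_add, integral_add_compl hΘΩ (hFint β hβ)]

/-- The same limit with the factor `e^{β f(Θ x₀)}` outside the integral:
`β^{d/2} e^{β f(Θ x₀)} ∫_X e^{−βf} φ dμ ⟶ (2π)^{d/2} (det A)^{−1/2} J(x₀) φ(Θ x₀)`.
[cite: Breitung1994, Thm 41 (5.24) p. 56 with §2.3 Definitions 4–5 pp. 14–15] -/
theorem tendsto_laplaceMethod_chart' {Θ : V → X} {Ω : Set V} {J : V → ℝ} {x₀ : V}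
    {f φ : X → ℝ} {A : V →ₗ[ℝ] V}
    (hA : A.IsSymmetric) (hpos : ∀ y, y ≠ 0 → 0 < ⟪A y, y⟫_ℝ)
    (hΘ : Measurable Θ) (hΩ : MeasurableSet Ω) (hΘΩ : MeasurableSet (Θ '' Ω)) (hx₀ : Ω ∈ 𝓝 x₀)
    (hJm : Measurable J) (hJ0 : ∀ v ∈ Ω, 0 ≤ J v)
    (hchart : μ.restrict (Θ '' Ω) = ((volume.restrict Ω).withDensity fun v => ENNReal.ofReal (J v)).map Θ)
    (hfm : Measurable f) (hφm : Measurable φ)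
    (hS2 : (fun v => f (Θ v) - f (Θ x₀) - (1 / 2) * ⟪A (v - x₀), v - x₀⟫_ℝ) =o[𝓝 x₀] fun v => ‖v - x₀‖ ^ 2)
    (hsep : ∀ δ : ℝ, 0 < δ → ∃ η : ℝ, 0 < η ∧ ∀ v ∈ Ω, δ ≤ ‖v - x₀‖ → f (Θ x₀) + η ≤ f (Θ v))
    (hout : ∃ η₀ : ℝ, 0 < η₀ ∧ ∀ x, x ∉ Θ '' Ω → f (Θ x₀) + η₀ ≤ f x)
    (hJ : ContinuousAt J x₀) (hφ : ContinuousAt (fun v => φ (Θ v)) x₀)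
    {β₀ : ℝ} (hint : Integrable (fun x => Real.exp (-β₀ * f x) * φ x) μ) :
    Tendsto (fun β : ℝ => β ^ ((finrank ℝ V : ℝ) / 2) * Real.exp (β * f (Θ x₀)) *
        ∫ x, Real.exp (-β * f x) * φ x ∂μ) atTop
      (𝓝 ((2 * π) ^ ((finrank ℝ V : ℝ) / 2) / Real.sqrt (LinearMap.det A) * (J x₀ * φ (Θ x₀)))) := by
  refine (tendsto_laplaceMethod_chart hA hpos hΘ hΩ hΘΩ hx₀ hJm hJ0 hchart hfm hφm hS2 hsep hout hJ hφ
    hint).congr' (Eventually.of_forall fun β => ?_)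
  show β ^ ((finrank ℝ V : ℝ) / 2) * ∫ x, Real.exp (-β * (f x - f (Θ x₀))) * φ x ∂μ =
    β ^ ((finrank ℝ V : ℝ) / 2) * Real.exp (β * f (Θ x₀)) * ∫ x, Real.exp (-β * f x) * φ x ∂μ
  rw [mul_assoc, ← integral_const_mul (Real.exp (β * f (Θ x₀)))]
  refine congrArg (fun t : ℝ => β ^ ((finrank ℝ V : ℝ) / 2) * t)
    (integral_congr_ae (Eventually.of_forall fun x => ?_))
  show Real.exp (-β * (f x - f (Θ x₀))) * φ x = Real.exp (β * f (Θ x₀)) * (Real.exp (-β * f x) * φ x)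
  rw [← mul_assoc, ← Real.exp_add]
  congr 2
  ring

/-- **Gibbs expectations concentrate at the minimum, through a chart**: under the hypotheses of
`tendsto_laplaceMethod_chart` for the amplitude `φ` AND for the constant amplitude `1` (i.e. `e^{−β₀f} ∈ L¹(μ)`),
with `J(x₀) > 0`, the normalised means converge: `∫ e^{−βf} φ dμ ∕ ∫ e^{−βf} dμ ⟶ φ(Θ x₀)` — every constant
(`(2π/β)^{d/2}`, `det A`, the coordinate density `J(x₀)`) cancels.
[cite: Breitung1994, Thm 41 (5.24) p. 56 with §2.3 Definitions 4–5 pp. 14–15]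
[cite: Hwang1980, main theorem (weak limit of e^{−nℓ}dμ₀∕Z_n; one-point case = Dirac mass at the minimum)] -/
theorem tendsto_gibbs_expectation_laplace_chart {Θ : V → X} {Ω : Set V} {J : V → ℝ} {x₀ : V}
    {f φ : X → ℝ} {A : V →ₗ[ℝ] V}
    (hA : A.IsSymmetric) (hpos : ∀ y, y ≠ 0 → 0 < ⟪A y, y⟫_ℝ)
    (hΘ : Measurable Θ) (hΩ : MeasurableSet Ω) (hΘΩ : MeasurableSet (Θ '' Ω)) (hx₀ : Ω ∈ 𝓝 x₀)
    (hJm : Measurable J) (hJ0 : ∀ v ∈ Ω, 0 ≤ J v) (hJx₀ : 0 < J x₀)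
    (hchart : μ.restrict (Θ '' Ω) = ((volume.restrict Ω).withDensity fun v => ENNReal.ofReal (J v)).map Θ)
    (hfm : Measurable f) (hφm : Measurable φ)
    (hS2 : (fun v => f (Θ v) - f (Θ x₀) - (1 / 2) * ⟪A (v - x₀), v - x₀⟫_ℝ) =o[𝓝 x₀] fun v => ‖v - x₀‖ ^ 2)
    (hsep : ∀ δ : ℝ, 0 < δ → ∃ η : ℝ, 0 < η ∧ ∀ v ∈ Ω, δ ≤ ‖v - x₀‖ → f (Θ x₀) + η ≤ f (Θ v))
    (hout : ∃ η₀ : ℝ, 0 < η₀ ∧ ∀ x, x ∉ Θ '' Ω → f (Θ x₀) + η₀ ≤ f x)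
    (hJ : ContinuousAt J x₀) (hφ : ContinuousAt (fun v => φ (Θ v)) x₀)
    {β₀ : ℝ} (hint : Integrable (fun x => Real.exp (-β₀ * f x) * φ x) μ)
    (hint₁ : Integrable (fun x => Real.exp (-β₀ * f x)) μ) :
    Tendsto (fun β : ℝ => (∫ x, Real.exp (-β * f x) * φ x ∂μ) / ∫ x, Real.exp (-β * f x) ∂μ) atTop
      (𝓝 (φ (Θ x₀))) := by
  set C := (2 * π) ^ ((finrank ℝ V : ℝ) / 2) / Real.sqrt (LinearMap.det A) with hC
  have hCpos : 0 < C := by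
    have hdet : 0 < LinearMap.det A := det_pos_of_inner_pos hA hpos
    positivity
  have hnum := tendsto_laplaceMethod_chart' hA hpos hΘ hΩ hΘΩ hx₀ hJm hJ0 hchart hfm hφm hS2 hsep hout hJ hφ hint
  have hden : Tendsto (fun β : ℝ => β ^ ((finrank ℝ V : ℝ) / 2) * Real.exp (β * f (Θ x₀)) *
      ∫ x, Real.exp (-β * f x) ∂μ) atTop (𝓝 (C * (J x₀ * 1))) := by
    have h1 : Integrable (fun x => Real.exp (-β₀ * f x) * (fun _ => (1 : ℝ)) x) μ := by simpa using hint₁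
    have h := tendsto_laplaceMethod_chart' (φ := fun _ => (1 : ℝ)) hA hpos hΘ hΩ hΘΩ hx₀ hJm hJ0 hchart hfm
      measurable_const hS2 hsep hout hJ continuousAt_const h1
    simpa using h
  have hne : C * (J x₀ * 1) ≠ 0 := by positivity
  have hq := hnum.div hden hne
  have hval : C * (J x₀ * φ (Θ x₀)) / (C * (J x₀ * 1)) = φ (Θ x₀) := by
    field_simp
  rw [hval] at hq
  refine hq.congr' ?_
  filter_upwards [eventually_gt_atTop 0] with β hβ
  have hpow : β ^ ((finrank ℝ V : ℝ) / 2) * Real.exp (β * f (Θ x₀)) ≠ 0 := by positivity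
  simp only [Pi.div_apply]
  rw [mul_div_mul_left _ _ hpow]

end Point

/-! ## §3 A non-degenerate manifold of minima through a fibred chart (tubular coordinates) -/

section Fibred

variable {M : Type*} [MeasurableSpace M] {ν : Measure M} [SFinite ν]

/-- **Laplace's method with a non-degenerate manifold of minima, through a fibred chart (tubular coordinates with
Jacobian).**  Let `(X, μ)` be a measure space, `(M, ν)` an s-finite measure space (the critical manifold with the
measure it carries — e.g. a gauge orbit with Haar measure), `V` a finite-dimensional real inner product space of
dimension `m` (the transversal directions), `Ψ : M × V → X` measurable (the tubular parametrisation), `W ⊆ M × V`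
measurable with `Ψ(W)` measurable and containing the tube `M × {‖y‖ < r}` (`r > 0`), and `J ≥ 0` on `W` measurable
with the FIBRED CHART IDENTITY `μ|_{Ψ(W)} = Ψ_*((J · ν ⊗ dy)|_W)` («`dμ = J dν dy` in tubular coordinates»).  Let
`f, φ : X → ℝ` be measurable with, for a field of symmetric operators `A p` uniformly coercive
(`c‖y‖² ≤ ⟪A p y, y⟫`, `c > 0`):

* uniform Peano expansion across the zero section: `|f(Ψ(p,y)) − f₀ − ½⟪A p y, y⟫| ≤ ε‖y‖²` for `‖y‖ < δ(ε)`, all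
  `p` (so `f∘Ψ = f₀` on `M × {0}`);
* separation inside the tube: `f(Ψ(p,y)) ≥ f₀ + η(δ)` for `(p,y) ∈ W`, `‖y‖ ≥ δ`; separation off the tube:
  `f ≥ f₀ + η₀` on `X ∖ Ψ(W)` (`η₀ > 0`);
* `y ↦ J(p,y)·φ(Ψ(p,y))` continuous at `0` and `≤ G(p)` in absolute value for `‖y‖ < δ₁`, with `G ∈ L¹(ν)`;
* `e^{−β₀ f} φ ∈ L¹(μ)` for one `β₀`.

Then `β^{m/2} ∫_X e^{−β(f − f₀)} φ dμ ⟶ (2π)^{m/2} ∫_M J(p,0) φ(Ψ(p,0)) (det A p)^{−1/2} dν(p)` as `β → ∞`.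
This is `tendsto_laplaceMethod_fibred` (Hasenpflug–Rudolf–Sprungk Thm 16 ∕ Hwang) composed with the tubular step
(T) of HRS's Assumption 3 at MEASURE level: the consumer supplies the coordinates `Ψ`, the tube `W` and the
Jacobian `J` with `hchart`; the differential topology producing them is not done here.  Proof: `X = Ψ(W) ⊔ Ψ(W)ᶜ`,
pull back the tube integral (`setIntegral_image_eq_of_chart`), apply the fibred Euclidean theorem to `f∘Ψ`
extended by `f₀ + 1` off `W` and the amplitude `1_W · J · φ∘Ψ`; the complement is `O(e^{−(β−β₀)η₀})`.
[cite: HasenpflugRudolfSprungk2024, §3.1 Assumption 3 (M)(T)(P) (tubular coordinates S_i, reference measure) and App. 4.1 Thm 16 ∕ Remark 17]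
[cite: Hwang1980, main theorem (minimum set a manifold; limit density ∝ π₀ · det of the transversal Hessian^{−1/2})]
[cite: Breitung1994, Thm 41 p. 56 with §2.3 Definitions 4–5 pp. 14–15 (local coordinates)] -/
theorem tendsto_laplaceMethod_fibred_chart {Ψ : M × V → X} {W : Set (M × V)} {J : M × V → ℝ}
    {f φ : X → ℝ} {f₀ : ℝ} {A : M → V →ₗ[ℝ] V} {c r : ℝ}
    (hA : ∀ p, (A p).IsSymmetric) (hc : 0 < c) (hcoer : ∀ p y, c * ‖y‖ ^ 2 ≤ ⟪A p y, y⟫_ℝ)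
    (hΨ : Measurable Ψ) (hW : MeasurableSet W) (hΨW : MeasurableSet (Ψ '' W))
    (hr : 0 < r) (hrW : ∀ p y, ‖y‖ < r → (p, y) ∈ W)
    (hJm : Measurable J) (hJ0 : ∀ z ∈ W, 0 ≤ J z)
    (hchart : μ.restrict (Ψ '' W) =
      (((ν.prod volume).restrict W).withDensity fun z => ENNReal.ofReal (J z)).map Ψ)
    (hfm : Measurable f) (hφm : Measurable φ)
    (hS2 : ∀ ε : ℝ, 0 < ε → ∃ δ : ℝ, 0 < δ ∧ ∀ p y, ‖y‖ < δ →
      |f (Ψ (p, y)) - f₀ - (1 / 2) * ⟪A p y, y⟫_ℝ| ≤ ε * ‖y‖ ^ 2)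
    (hsep : ∀ δ : ℝ, 0 < δ → ∃ η : ℝ, 0 < η ∧ ∀ p y, (p, y) ∈ W → δ ≤ ‖y‖ → f₀ + η ≤ f (Ψ (p, y)))
    (hout : ∃ η₀ : ℝ, 0 < η₀ ∧ ∀ x, x ∉ Ψ '' W → f₀ + η₀ ≤ f x)
    (hg : ∀ p, ContinuousAt (fun y => J (p, y) * φ (Ψ (p, y))) 0)
    {G : M → ℝ} (hG : Integrable G ν) {δ₁ : ℝ} (hδ₁ : 0 < δ₁)
    (hgG : ∀ p y, ‖y‖ < δ₁ → |J (p, y) * φ (Ψ (p, y))| ≤ G p)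
    {β₀ : ℝ} (hint : Integrable (fun x => Real.exp (-β₀ * f x) * φ x) μ) :
    Tendsto (fun β : ℝ => β ^ ((finrank ℝ V : ℝ) / 2) *
        ∫ x, Real.exp (-β * (f x - f₀)) * φ x ∂μ) atTop
      (𝓝 ((2 * π) ^ ((finrank ℝ V : ℝ) / 2) *
        ∫ p, J (p, 0) * φ (Ψ (p, 0)) / Real.sqrt (LinearMap.det (A p)) ∂ν)) := by
  classical
  set d := finrank ℝ V with hd
  -- the pulled-back phase (extended by `f₀ + 1` off `W`) and amplitude (`1_W · J · φ∘Ψ`) on `M × V`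
  set S : M × V → ℝ := W.piecewise (fun z => f (Ψ z)) (fun _ => f₀ + 1) with hS
  set g : M × V → ℝ := W.indicator fun z => J z * φ (Ψ z) with hgdef
  have hSW : ∀ z ∈ W, S z = f (Ψ z) := fun z hz => Set.piecewise_eq_of_mem _ _ _ hz
  have hSWc : ∀ z ∉ W, S z = f₀ + 1 := fun z hz => Set.piecewise_eq_of_notMem _ _ _ hz
  have hSm : Measurable S := Measurable.piecewise hW (hfm.comp hΨ) measurable_const
  have hgm : Measurable g := (hJm.mul (hφm.comp hΨ)).indicator hW
  have hW0 : ∀ p, (p, (0 : V)) ∈ W := fun p => hrW p 0 (by rwa [norm_zero])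
  have hg0 : ∀ p, g (p, 0) = J (p, 0) * φ (Ψ (p, 0)) := fun p => by
    simp only [hgdef, Set.indicator_of_mem (hW0 p)]
  -- the hypotheses of the fibred Euclidean theorem for `(S, g)`
  have hS2' : ∀ ε : ℝ, 0 < ε → ∃ δ : ℝ, 0 < δ ∧ ∀ p y, ‖y‖ < δ →
      |S (p, y) - f₀ - (1 / 2) * ⟪A p y, y⟫_ℝ| ≤ ε * ‖y‖ ^ 2 := by
    intro ε hε
    obtain ⟨δ, hδ, h⟩ := hS2 ε hε
    refine ⟨min δ r, lt_min hδ hr, fun p y hy => ?_⟩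
    rw [hSW _ (hrW p y (lt_of_lt_of_le hy (min_le_right _ _)))]
    exact h p y (lt_of_lt_of_le hy (min_le_left _ _))
  have hsep' : ∀ δ : ℝ, 0 < δ → ∃ η : ℝ, 0 < η ∧ ∀ p y, δ ≤ ‖y‖ → f₀ + η ≤ S (p, y) := by
    intro δ hδ
    obtain ⟨η, hη, h⟩ := hsep δ hδ
    refine ⟨min η 1, lt_min hη one_pos, fun p y hy => ?_⟩
    by_cases hz : (p, y) ∈ W
    · rw [hSW _ hz]
      linarith [h p y hz hy, min_le_left η 1]
    · rw [hSWc _ hz]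
      linarith [min_le_right η 1]
  have hg' : ∀ p, ContinuousAt (fun y => g (p, y)) 0 := by
    intro p
    have hev : (fun y => J (p, y) * φ (Ψ (p, y))) =ᶠ[𝓝 (0 : V)] fun y => g (p, y) := by
      filter_upwards [Metric.ball_mem_nhds (0 : V) hr] with y hy
      rw [Metric.mem_ball, dist_zero_right] at hy
      simp only [hgdef, Set.indicator_of_mem (hrW p y hy)]
    exact (hg p).congr hev
  have hgG' : ∀ p y, ‖y‖ < δ₁ → |g (p, y)| ≤ G p := by
    intro p y hy
    by_cases hz : (p, y) ∈ W
    · simp only [hgdef, Set.indicator_of_mem hz]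
      exact hgG p y hy
    · simp only [hgdef, Set.indicator_of_notMem hz, abs_zero]
      have h0 := hgG p 0 (by rwa [norm_zero])
      exact (abs_nonneg _).trans h0
  -- integrability of the pulled-back weight, through the chart identity
  have hFm : ∀ β : ℝ, Measurable fun x => Real.exp (-β * f x) * φ x := fun β =>
    (Real.measurable_exp.comp (hfm.const_mul _)).mul hφm
  have hint' : Integrable (fun z => Real.exp (-β₀ * S z) * g z) (ν.prod volume) := by
    have h2 := (integrableOn_image_iff_of_chart hΨ hW hJm hJ0 hchart (hFm β₀)).1 hint.integrableOn
    rw [← integrable_indicator_iff hW] at h2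
    refine h2.congr (Eventually.of_forall fun z => ?_)
    by_cases hz : z ∈ W
    · simp only [Set.indicator_of_mem hz, hgdef, hSW z hz]
      ring
    · simp only [Set.indicator_of_notMem hz, hgdef, mul_zero]
  -- ★ the fibred Euclidean Laplace theorem on `M × V`
  have hmain := tendsto_laplaceMethod_fibred hA hc hcoer hSm hgm hS2' hsep' hg' hG hδ₁ hgG' hint'
  have hlimval : (∫ p, g (p, 0) / Real.sqrt (LinearMap.det (A p)) ∂ν) =
      ∫ p, J (p, 0) * φ (Ψ (p, 0)) / Real.sqrt (LinearMap.det (A p)) ∂ν := by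
    refine integral_congr_ae (Eventually.of_forall fun p => ?_)
    simp only [hg0 p]
  rw [hlimval] at hmain
  -- the global lower bound `f ≥ f₀`
  obtain ⟨η₀, hη₀, hout⟩ := hout
  have hfge : ∀ x, f₀ ≤ f x := by
    have hc4 : 0 < c / 4 := by positivity
    obtain ⟨ρ, hρ, hT⟩ := hS2' (c / 4) hc4
    obtain ⟨η, hη, hsepρ⟩ := hsep' ρ hρ
    have hSge : ∀ p y, f₀ ≤ S (p, y) := by
      intro p y
      rcases lt_or_ge ‖y‖ ρ with h | h
      · have h1 := hT p y h
        have h2 := hcoer p y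
        have h3 := neg_abs_le (S (p, y) - f₀ - (1 / 2) * ⟪A p y, y⟫_ℝ)
        nlinarith
      · linarith [hsepρ p y h]
    intro x
    by_cases hx : x ∈ Ψ '' W
    · obtain ⟨⟨p, y⟩, hz, rfl⟩ := hx
      have := hSge p y
      rwa [hSW _ hz] at this
    · linarith [hout x hx]
  -- the integrands on `X`, their integrable envelope, the tail estimate off the tube
  set F : ℝ → X → ℝ := fun β x => Real.exp (-β * (f x - f₀)) * φ x with hF
  have hFm' : ∀ β, Measurable (F β) := fun β =>
    (Real.measurable_exp.comp ((hfm.sub measurable_const).const_mul _)).mul hφm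
  set K : X → ℝ := fun x => Real.exp (-β₀ * (f x - f₀)) * |φ x| with hK
  have hKint : Integrable K μ := by
    have hKeq : K = fun x => Real.exp (β₀ * f₀) * |Real.exp (-β₀ * f x) * φ x| := by
      funext x
      simp only [hK]
      rw [abs_mul, abs_of_pos (Real.exp_pos _), show -β₀ * (f x - f₀) = β₀ * f₀ + -β₀ * f x by ring,
        Real.exp_add]
      ring
    rw [hKeq]
    exact hint.abs.const_mul _
  have hKnn : ∀ x, 0 ≤ K x := fun x => by positivity
  have hFK : ∀ β, β₀ ≤ β → ∀ x, |F β x| ≤ K x := by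
    intro β hβ x
    simp only [hF, hK, abs_mul, abs_of_pos (Real.exp_pos _)]
    refine mul_le_mul_of_nonneg_right ?_ (abs_nonneg _)
    rw [Real.exp_le_exp]
    have := hfge x
    nlinarith
  have hFint : ∀ β, β₀ ≤ β → Integrable (F β) μ := fun β hβ =>
    Integrable.mono' hKint (hFm' β).aestronglyMeasurable
      (Eventually.of_forall fun x => by rw [Real.norm_eq_abs]; exact hFK β hβ x)
  have hFtail : ∀ β, β₀ ≤ β → ∀ x, x ∉ Ψ '' W → |F β x| ≤ Real.exp (-(β - β₀) * η₀) * K x := by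
    intro β hβ x hx
    have hfx := hout x hx
    simp only [hF, hK, abs_mul, abs_of_pos (Real.exp_pos _)]
    rw [← mul_assoc, ← Real.exp_add]
    refine mul_le_mul_of_nonneg_right ?_ (abs_nonneg _)
    rw [Real.exp_le_exp]
    have h1 : 0 ≤ (β - β₀) * (f x - f₀ - η₀) := mul_nonneg (sub_nonneg.2 hβ) (by linarith)
    nlinarith
  -- (a) the tube integral IS the fibred Euclidean Laplace integral of `(S, g)`
  have hin : ∀ β, ∫ x in Ψ '' W, F β x ∂μ = ∫ z, Real.exp (-β * (S z - f₀)) * g z ∂(ν.prod volume) := by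
    intro β
    rw [setIntegral_image_eq_of_chart hΨ hW hJm hJ0 hchart (hFm' β), ← integral_indicator hW]
    refine integral_congr_ae (Eventually.of_forall fun z => ?_)
    by_cases hz : z ∈ W
    · simp only [Set.indicator_of_mem hz, hF, hgdef, hSW z hz]
      ring
    · simp only [Set.indicator_of_notMem hz, hgdef, mul_zero]
  -- (b) the complement of the tube is negligible
  have htail : Tendsto (fun β : ℝ => β ^ ((d : ℝ) / 2) * ∫ x in (Ψ '' W)ᶜ, F β x ∂μ) atTop (𝓝 0) := by
    have hKI : 0 ≤ ∫ x, K x ∂μ := integral_nonneg hKnn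
    have hlim : Tendsto (fun β : ℝ => Real.exp (β₀ * η₀) * (∫ x, K x ∂μ) * (β ^ ((d : ℝ) / 2) * Real.exp (-η₀ * β)))
        atTop (𝓝 0) := by
      have := (tendsto_rpow_mul_exp_neg_mul_atTop_nhds_zero ((d : ℝ) / 2) η₀ hη₀).const_mul
        (Real.exp (β₀ * η₀) * ∫ x, K x ∂μ)
      simpa using this
    refine squeeze_zero_norm' ?_ hlim
    filter_upwards [eventually_ge_atTop β₀, eventually_gt_atTop 0] with β hβ hβpos
    rw [Real.norm_eq_abs, abs_mul, abs_of_nonneg (by positivity : 0 ≤ β ^ ((d : ℝ) / 2))]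
    have hI : |∫ x in (Ψ '' W)ᶜ, F β x ∂μ| ≤ Real.exp (-(β - β₀) * η₀) * ∫ x, K x ∂μ := by
      calc |∫ x in (Ψ '' W)ᶜ, F β x ∂μ| ≤ ∫ x in (Ψ '' W)ᶜ, |F β x| ∂μ := abs_integral_le_integral_abs
        _ ≤ ∫ x in (Ψ '' W)ᶜ, Real.exp (-(β - β₀) * η₀) * K x ∂μ := by
            refine setIntegral_mono_on (hFint β hβ).abs.integrableOn (hKint.const_mul _).integrableOn
              hΨW.compl fun x hx => hFtail β hβ x hx
        _ = Real.exp (-(β - β₀) * η₀) * ∫ x in (Ψ '' W)ᶜ, K x ∂μ := integral_const_mul _ _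
        _ ≤ Real.exp (-(β - β₀) * η₀) * ∫ x, K x ∂μ :=
            mul_le_mul_of_nonneg_left (setIntegral_le_integral hKint (Eventually.of_forall hKnn))
              (Real.exp_pos _).le
    calc β ^ ((d : ℝ) / 2) * |∫ x in (Ψ '' W)ᶜ, F β x ∂μ|
        ≤ β ^ ((d : ℝ) / 2) * (Real.exp (-(β - β₀) * η₀) * ∫ x, K x ∂μ) := by gcongr
      _ = Real.exp (β₀ * η₀) * (∫ x, K x ∂μ) * (β ^ ((d : ℝ) / 2) * Real.exp (-η₀ * β)) := by
          rw [show -(β - β₀) * η₀ = β₀ * η₀ + -η₀ * β by ring, Real.exp_add]; ring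
  -- (c) assemble
  have hsum := hmain.add htail
  rw [add_zero] at hsum
  refine hsum.congr' ?_
  filter_upwards [eventually_ge_atTop β₀] with β hβ
  rw [← hin β, ← mul_add, integral_add_compl hΨW (hFint β hβ)]

end Fibred

end Literature.Analysis.Asymptotics
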